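import Summits.NavierStokesRegularity.NavierStokesRegularity.Theorems.TaoForcedUniqueness.Negative.SerrinEnstrophyJunkFamily

/-!
# KJ-6 (4/9): the FORCE `f t = κ(t) • U_{λ(t)} + Φ_{λ(t), ℓ(t)}`, the typed hypotheses of the facts, and the cheap Leray–Hopf fields of the witness

Cell `ns-blowup`, seat `ns-blowup-refuter` (g10 blueprint, g11 kernel), KILLSHEET §XXIV rows KJ-6/KJ-7,
part 4/9 of the kernel certificate `¬ Literature.Analysis.FluidPDE.Sohr2001_serrinClass_enstrophyBound(_global)`
(final file `SohrSerrinEnstrophyCountableJunk.lean` in this directory, which carries the full account and the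
classification). LABEL: refuter construction (explicit data + proved lemmas; no named facts, no `sorry`).
WHAT THIS IS NOT: not Navier–Stokes evidence and not a statement about Sohr's printed theorem — a hygiene
refutation of two facts AS TYPED (slice-wise force class `MemLqLp 2 2`, one outer Bochner integral in the
weak form); nothing here mentions the summit.

Content: `fW J ℓ ν T`; the zero datum (`MemLp 0 2`, `eWeakGradL2Sq 0 < ⊤`; weak divergence-freeness of `0` is inlined where used); the Serrin
arithmetic `3/6 + 2/4 ≤ 1`; the FORCE CLASS `memLqLp_fW : MemLqLp 2 2 f (Ioo 0 T′)` for `T′ ≤ T` (slices in `L²`,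
`‖f t‖₂ ≤ κ(t)‖U‖₂ + 1`, `κ ∈ L²`) and the SERRIN CLASS `memLqLp_uW : MemLqLp 4 6 u (Ioo 0 T′)`; the fields
`memLp`, `energy_bound`, `strong_initial` and the `0⁺` weak limit of `IsLerayHopfOn` for the witness; weak
divergence-freeness of the slices, joint measurability (`measurable_uW`), local square integrability on
`(0,T) × K`; the slices are `C¹` (`contDiff_uW`).
-/

noncomputable section

namespace Summit.NavierStokesRegularity.ForcedUniquenessHygiene.KJ6

open MeasureTheory Set Function Filter Topology Metric
open scoped ENNReal NNReal RealInnerProductSpace ContDiff Laplacian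
open Literature.Analysis.FluidPDE Literature.Analysis.FunctionSpaces

/-- Euclidean `ℝ³` (file-local notation, as in the `Literature.Analysis.FluidPDE` files). -/
local notation "ℝ³" => EuclideanSpace ℝ (Fin 3)

variable {Pr : Profile} (J : JunkFamily Pr)

/-- The force witness `f t = κ(t) • U_{λ(t)} + Φ_{λ(t), ℓ(t)}`. -/
def fW (ℓ : ℝ → ℕ) (ν T : ℝ) (t : ℝ) (x : ℝ³) : ℝ³ :=
  kappa Pr ν T t • dilate (lam T t) Pr.U x + J.Φ (lam T t) (ℓ t) x

/-! ## §4 Hypotheses of the fact hold for the witness -/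

/-- The zero datum is in `L²`. -/
theorem memLp_zero_datum : MemLp (0 : ℝ³ → ℝ³) 2 volume := by
  exact MemLp.zero

/-- The zero datum has finite (zero) dissipation. -/
theorem eWeakGradL2Sq_zero_lt_top : eWeakGradL2Sq (0 : ℝ³ → ℝ³) < ⊤ := by
  have h := eWeakGradL2Sq_const_smul_le 0 (0 : ℝ³ → ℝ³)
  rw [zero_smul] at h
  refine lt_of_le_of_lt h ?_
  simp

/-- Serrin exponents `(s, q) = (4, 6)`: `3/6 + 2/4 ≤ 1` in `ℝ≥0∞`. -/
theorem serrin_pair_46 : (3 : ℝ≥0∞) / 6 + 2 / 4 ≤ 1 := by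
  have h1 : (3 : ℝ≥0∞) / 6 = 1 / 2 := by
    rw [ENNReal.div_eq_div_iff] <;> norm_num
  have h2 : (2 : ℝ≥0∞) / 4 = 1 / 2 := by
    rw [ENNReal.div_eq_div_iff] <;> norm_num
  rw [h1, h2, ENNReal.div_add_div_same, ENNReal.div_le_iff] <;> norm_num

section Hyps
variable {P : ℕ → Set ℝ} {ℓ : ℝ → ℕ} {ν T : ℝ}

/-- `‖Φ_{c,m}‖₂ ≤ 1`. -/
theorem eLpNorm_junk_le_one (c : ℝ) (m : ℕ) : eLpNorm (J.Φ c m) 2 volume ≤ 1 := J.norm_le c m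

/-- Slice formula for the force: `f t = κ(t) • U_{λ(t)} + Φ_{λ(t), ℓ(t)}`. -/
theorem fW_slice (ℓ : ℝ → ℕ) (ν T t : ℝ) :
    fW J ℓ ν T t = kappa Pr ν T t • dilate (lam T t) Pr.U + J.Φ (lam T t) (ℓ t) := by
  funext x; rfl

/-- `U_c ∈ L²` for `c > 0`. -/
theorem memLp_dilate_two {c : ℝ} (hc : 0 < c) : MemLp (dilate c Pr.U) 2 volume := by
  unfold dilate
  exact (memLp_nsRescaleData (memLp_profile_two Pr) hc.ne').const_smul _

/-- Every slice of the force is in `L²`. -/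
theorem memLp_fW_slice (ℓ : ℝ → ℕ) (ν T t : ℝ) : MemLp (fW J ℓ ν T t) 2 volume := by
  rw [fW_slice]
  exact ((memLp_dilate_two (Pr := Pr) (lam_pos T t)).const_smul _).add (J.memLp _ _)

/-- `‖f(t)‖₂ ≤ |κ(t)| ‖U‖₂ + 1`. -/
theorem eLpNorm_fW_le (ℓ : ℝ → ℕ) (ν T t : ℝ) :
    eLpNorm (fW J ℓ ν T t) 2 volume ≤ ‖kappa Pr ν T t‖ₑ * eLpNorm Pr.U 2 volume + 1 := by
  rw [fW_slice]
  refine (eLpNorm_add_le ((memLp_dilate_two (Pr := Pr) (lam_pos T t)).const_smul _).aestronglyMeasurable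
    (J.memLp _ _).aestronglyMeasurable (by norm_num)).trans ?_
  rw [eLpNorm_const_smul, eLpNorm_dilate_two (lam_pos T t)]
  gcongr
  exact eLpNorm_junk_le_one J _ _

/-- `f ∈ L²(0,T′; L²)` for every `T′ ≤ T` (slices smooth; `‖f t‖₂ ≤ κ(t)‖U‖₂ + 1`, `κ ∈ L²(0,T)`
since `λ⁴ ~ |t − T/2|^{-1/2}` is integrable). -/
theorem memLqLp_fW (hν : 0 < ν) (_hT : 0 < T) {T' : ℝ} (hT' : T' ≤ T) :
    MemLqLp 2 2 (fW J ℓ ν T) (Ioo 0 T') := by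
  refine ⟨Eventually.of_forall fun t => memLp_fW_slice J ℓ ν T t, ?_⟩
  rw [eLqLpNorm_def]
  set N := (eLpNorm Pr.U 2 volume).toReal with hN_def
  have hN : eLpNorm Pr.U 2 volume ≠ ⊤ := (memLp_profile_two Pr).eLpNorm_ne_top
  have hN0 : 0 ≤ N := ENNReal.toReal_nonneg
  set A := N + 1
  set B := ν * T * c₁ Pr * N
  have hbound : ∀ᵐ t ∂(volume.restrict (Ioo 0 T')),
      ‖(eLpNorm (fW J ℓ ν T t) 2 volume).toReal‖ ≤ ‖A + B * lamSq T t‖ := by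
    filter_upwards [ae_restrict_mem measurableSet_Ioo] with t ht
    rw [Real.norm_of_nonneg ENNReal.toReal_nonneg]
    refine le_trans ?_ (le_abs_self _)
    have hfin : ‖kappa Pr ν T t‖ₑ * eLpNorm Pr.U 2 volume + 1 ≠ ⊤ :=
      ENNReal.add_ne_top.2 ⟨ENNReal.mul_ne_top enorm_ne_top hN, ENNReal.one_ne_top⟩
    have h1 := ENNReal.toReal_mono hfin (eLpNorm_fW_le J ℓ ν T t)
    rw [ENNReal.toReal_add (ENNReal.mul_ne_top enorm_ne_top hN) ENNReal.one_ne_top, ENNReal.toReal_mul,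
      Real.enorm_eq_ofReal_abs, ENNReal.toReal_ofReal (abs_nonneg _), ENNReal.toReal_one] at h1
    refine h1.trans ?_
    have hk0 := kappa_nonneg (T := T) Pr hν.le ht.1.le
    have hk := kappa_le (T := T) Pr hν.le (show t ≤ T by linarith [ht.2])
    rw [abs_of_nonneg hk0]
    have : kappa Pr ν T t * N ≤ (1 + ν * T * c₁ Pr * lamSq T t) * N := by gcongr
    have hAB : (1 + ν * T * c₁ Pr * lamSq T t) * N + 1 = A + B * lamSq T t := by
      simp only [A, B]; ring
    linarith
  refine lt_of_le_of_lt (eLpNorm_mono_ae hbound) ?_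
  exact ((memLp_const A).add ((memLp_lamSq T 0 T').const_mul B)).eLpNorm_lt_top

/-- `u ∈ L⁴(0,T′; L⁶)`: `‖u t‖₆ = t λ(t) ‖U‖₆`, `∫ t⁴ λ⁴ < ∞`. -/
theorem memLqLp_uW (_hT : 0 < T) {T' : ℝ} (hT' : T' ≤ T) :
    MemLqLp 4 6 (uW Pr T) (Ioo 0 T') := by
  refine ⟨Eventually.of_forall fun t => memLp_uW_slice Pr T t, ?_⟩
  rw [eLqLpNorm_def]
  set N := (eLpNorm Pr.U 6 volume).toReal with hN_def
  have hN : eLpNorm Pr.U 6 volume ≠ ⊤ := (memLp_profile_six Pr).eLpNorm_ne_top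
  have hN0 : 0 ≤ N := ENNReal.toReal_nonneg
  have hbound : ∀ᵐ t ∂(volume.restrict (Ioo 0 T')),
      ‖(eLpNorm (uW Pr T t) 6 volume).toReal‖ ≤ ‖T * N * lam T t‖ := by
    filter_upwards [ae_restrict_mem measurableSet_Ioo] with t ht
    rw [Real.norm_of_nonneg ENNReal.toReal_nonneg]
    refine le_trans ?_ (le_abs_self _)
    have h1 := ENNReal.toReal_mono (ENNReal.mul_ne_top ENNReal.ofReal_ne_top hN) (eLpNorm_uW_le Pr T t)
    rw [ENNReal.toReal_mul, ENNReal.toReal_ofReal (mul_nonneg (abs_nonneg t) (lam_pos T t).le)] at h1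
    refine h1.trans ?_
    have ht' : |t| ≤ T := by rw [abs_of_pos ht.1]; linarith [ht.2]
    have hl := (lam_pos T t).le
    calc |t| * lam T t * N ≤ T * lam T t * N := by gcongr
      _ = T * N * lam T t := by ring
  refine lt_of_le_of_lt (eLpNorm_mono_ae hbound) ?_
  exact ((memLp_lam T 0 T').const_mul (T * N)).eLpNorm_lt_top

/-! ### Cheap fields of `IsLerayHopfOn` for the witness (`memLp`, `energy_bound`, `strong_initial`,
the `0⁺` weak limit) and the TYPED statements of the three remaining obligations -/

/-- `‖u(t)‖₂ ≤ |t| ‖U‖₂` (equality off `t = T/2`: the dilate is `L²`-unitary). -/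
theorem eLpNorm_uW_two_le (T t : ℝ) :
    eLpNorm (uW Pr T t) 2 volume ≤ ENNReal.ofReal |t| * eLpNorm Pr.U 2 volume := by
  unfold uW
  split_ifs with h
  · simp
  · rw [eLpNorm_const_smul, eLpNorm_dilate_two (lam_pos T t), Real.enorm_eq_ofReal_abs]

/-- Every slice of the witness is in `L²`. -/
theorem memLp_uW_slice_two (T t : ℝ) : MemLp (uW Pr T t) 2 volume := by
  unfold uW
  split_ifs with h
  · exact MemLp.zero
  · exact (memLp_dilate_two (Pr := Pr) (lam_pos T t)).const_smul _

/-- Field `memLp` of `IsLerayHopfOn` for the witness. -/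
theorem uW_memLp_field (T : ℝ) : ∀ t ∈ Icc 0 T, MemLp (uW Pr T t) 2 volume :=
  fun t _ => memLp_uW_slice_two (Pr := Pr) T t

/-- Field `energy_bound`: `‖u(t)‖₂² ≤ T² ‖U‖₂²` for `t ∈ (0,T)`. -/
theorem uW_energy_bound (T : ℝ) :
    ∃ C : ℝ≥0, ∀ᵐ t ∂(volume.restrict (Ioo 0 T)), eEnergy (uW Pr T t) ≤ C := by
  have hN : eLpNorm Pr.U 2 volume ≠ ⊤ := (memLp_profile_two Pr).eLpNorm_ne_top
  have hfin : (ENNReal.ofReal T * eLpNorm Pr.U 2 volume) ^ 2 ≠ ⊤ :=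
    ENNReal.pow_ne_top (ENNReal.mul_ne_top ENNReal.ofReal_ne_top hN)
  refine ⟨((ENNReal.ofReal T * eLpNorm Pr.U 2 volume) ^ 2).toNNReal, ?_⟩
  filter_upwards [ae_restrict_mem measurableSet_Ioo] with t ht
  rw [ENNReal.coe_toNNReal hfin, eEnergy_eq_eLpNorm_sq]
  have hle : eLpNorm (uW Pr T t) 2 volume ≤ ENNReal.ofReal T * eLpNorm Pr.U 2 volume := by
    refine (eLpNorm_uW_two_le (Pr := Pr) T t).trans ?_
    exact mul_le_mul' (ENNReal.ofReal_le_ofReal (by rw [abs_of_pos ht.1]; exact ht.2.le)) le_rfl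
  exact pow_le_pow_left' hle 2

/-- Field `strong_initial`: `‖u(t) − 0‖₂ ≤ t ‖U‖₂ → 0` as `t → 0⁺`. -/
theorem uW_strong_initial (T : ℝ) :
    Tendsto (fun t => eLpNorm (uW Pr T t - 0) 2 volume) (𝓝[>] 0) (𝓝 0) := by
  have hN : eLpNorm Pr.U 2 volume ≠ ⊤ := (memLp_profile_two Pr).eLpNorm_ne_top
  have habs : Tendsto (fun t : ℝ => |t|) (𝓝 0) (𝓝 0) := by
    simpa using (continuous_abs.tendsto (0 : ℝ))
  have h1 : Tendsto (fun t : ℝ => ENNReal.ofReal |t|) (𝓝 0) (𝓝 0) := by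
    simpa using ENNReal.tendsto_ofReal habs
  have h2 : Tendsto (fun t : ℝ => ENNReal.ofReal |t| * eLpNorm Pr.U 2 volume) (𝓝[>] 0) (𝓝 0) := by
    have h := ENNReal.Tendsto.mul_const h1 (Or.inr hN)
    rw [zero_mul] at h
    exact h.mono_left nhdsWithin_le_nhds
  refine tendsto_of_tendsto_of_tendsto_of_le_of_le tendsto_const_nhds h2 (fun _ => zero_le)
    fun t => ?_
  simp only [sub_zero]
  exact eLpNorm_uW_two_le (Pr := Pr) T t

/-- Cauchy–Schwarz for the `L²` pairing through Mathlib's Hilbert space `L²` (the tree's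
`abs_integral_inner_le_eLpNorm` of `EulerSubsolutionCriterionChart.lean`, copied to keep imports light). -/
theorem abs_integral_inner_le_eLpNorm₂ {f h : ℝ³ → ℝ³} (hf : MemLp f 2 volume)
    (hh : MemLp h 2 volume) :
    |∫ x, ⟪f x, h x⟫| ≤ (eLpNorm f 2 volume).toReal * (eLpNorm h 2 volume).toReal := by
  have e : ∫ x, ⟪f x, h x⟫ = ⟪hf.toLp f, hh.toLp h⟫ := by
    rw [L2.inner_def]
    refine integral_congr_ae ?_
    filter_upwards [hf.coeFn_toLp, hh.coeFn_toLp] with x hx hy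
    rw [hx, hy]
  rw [e, ← Real.norm_eq_abs]
  refine (norm_inner_le_norm _ _).trans (le_of_eq ?_)
  rw [Lp.norm_toLp, Lp.norm_toLp]

/-- Half of field `weak_continuous`: the (strong, hence weak) limit `⟪u(t), w⟫ → ⟪0, w⟫ = 0` at `0⁺`. -/
theorem uW_weak_initial (T : ℝ) (w : ℝ³ → ℝ³) (hw : MemLp w 2 volume) :
    Tendsto (fun t => ∫ x, ⟪uW Pr T t x, w x⟫) (𝓝[>] 0) (𝓝 (∫ x, ⟪(0 : ℝ³ → ℝ³) x, w x⟫)) := by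
  have h0 : ∫ x, ⟪(0 : ℝ³ → ℝ³) x, w x⟫ = 0 := by simp
  rw [h0]
  have hN : eLpNorm Pr.U 2 volume ≠ ⊤ := (memLp_profile_two Pr).eLpNorm_ne_top
  have hb : ∀ t : ℝ, |∫ x, ⟪uW Pr T t x, w x⟫| ≤
      |t| * (eLpNorm Pr.U 2 volume).toReal * (eLpNorm w 2 volume).toReal := by
    intro t
    refine (abs_integral_inner_le_eLpNorm₂ (memLp_uW_slice_two (Pr := Pr) T t) hw).trans ?_
    gcongr
    have h := ENNReal.toReal_mono (ENNReal.mul_ne_top ENNReal.ofReal_ne_top hN)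
      (eLpNorm_uW_two_le (Pr := Pr) T t)
    rwa [ENNReal.toReal_mul, ENNReal.toReal_ofReal (abs_nonneg t)] at h
  have hlim : Tendsto (fun t : ℝ => |t| * (eLpNorm Pr.U 2 volume).toReal *
      (eLpNorm w 2 volume).toReal) (𝓝[>] 0) (𝓝 0) := by
    have h : Tendsto (fun t : ℝ => |t| * (eLpNorm Pr.U 2 volume).toReal *
        (eLpNorm w 2 volume).toReal) (𝓝 0)
        (𝓝 (|0| * (eLpNorm Pr.U 2 volume).toReal * (eLpNorm w 2 volume).toReal)) :=
      ((continuous_abs.tendsto 0).mul_const _).mul_const _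
    simp only [abs_zero, zero_mul] at h
    exact h.mono_left nhdsWithin_le_nhds
  refine squeeze_zero_norm (fun t => ?_) hlim
  rw [Real.norm_eq_abs]
  exact hb t

/-- Every slice of the witness is weakly divergence free (dilates and multiples of `Pr.divFree`). -/
theorem isWeaklyDivFree_uW (T t : ℝ) : IsWeaklyDivFree (uW Pr T t) := by
  unfold uW
  split_ifs with h
  · intro θ _; simp
  · intro θ hθ
    have h1 : ∫ x, ⟪nsRescaleData (lam T t) Pr.U x, gradient θ x⟫ = 0 :=
      (Pr.divFree.nsRescaleData (lam_pos T t)) θ hθ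
    simp only [dilate, Pi.smul_apply, real_inner_smul_left, integral_const_mul, h1, mul_zero]

/-- The witness is jointly measurable in `(t, x)` (`λ` measurable, `U` continuous). -/
theorem measurable_uW (T : ℝ) : Measurable (uncurry (uW Pr T)) := by
  have hU : Measurable Pr.U := Pr.smooth.continuous.measurable
  have hl : Measurable fun p : ℝ × ℝ³ => lam T p.1 := (measurable_lam T).comp measurable_fst
  have h1 : Measurable fun p : ℝ × ℝ³ =>
      p.1 • (Real.sqrt (lam T p.1) • (lam T p.1 • Pr.U (lam T p.1 • p.2))) :=
    measurable_fst.smul (hl.sqrt.smul (hl.smul (hU.comp (hl.smul measurable_snd))))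
  have hset : MeasurableSet {p : ℝ × ℝ³ | p.1 = T / 2} :=
    measurable_fst (measurableSet_singleton (T / 2))
  have heq : uncurry (uW Pr T) = fun p : ℝ × ℝ³ =>
      if p.1 = T / 2 then (0 : ℝ³) else
        p.1 • (Real.sqrt (lam T p.1) • (lam T p.1 • Pr.U (lam T p.1 • p.2))) := by
    funext p
    simp only [uncurry, uW]
    split_ifs with h
    · rfl
    · rfl
  rw [heq]
  exact Measurable.ite hset measurable_const h1

/-- `weak`, conjunct 1: `u` is a.e.-strongly measurable on `(0,T) × ℝ³`. -/
theorem aestronglyMeasurable_uW (T : ℝ) :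
    AEStronglyMeasurable (uncurry (uW Pr T)) (volume.restrict (Ioo 0 T ×ˢ univ)) :=
  (measurable_uW (Pr := Pr) T).aestronglyMeasurable

/-- `weak`, conjunct 2: `u ∈ L²((0,T) × K)` for every `K` — indeed `∫₀ᵀ‖u t‖₂² ≤ T · (T‖U‖₂)²`. -/
theorem lintegral_uW_sq_lt_top (T : ℝ) (K : Set ℝ³) :
    ∫⁻ z in Ioo 0 T ×ˢ K, ‖uncurry (uW Pr T) z‖ₑ ^ 2 < ⊤ := by
  have hN : eLpNorm Pr.U 2 volume ≠ ⊤ := (memLp_profile_two Pr).eLpNorm_ne_top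
  have hfin : (ENNReal.ofReal T * eLpNorm Pr.U 2 volume) ^ 2 ≠ ⊤ :=
    ENNReal.pow_ne_top (ENNReal.mul_ne_top ENNReal.ofReal_ne_top hN)
  have hmeas : Measurable fun z : ℝ × ℝ³ => ‖uncurry (uW Pr T) z‖ₑ ^ 2 :=
    (measurable_uW (Pr := Pr) T).enorm.pow_const 2
  calc ∫⁻ z in Ioo 0 T ×ˢ K, ‖uncurry (uW Pr T) z‖ₑ ^ 2
      ≤ ∫⁻ z in Ioo 0 T ×ˢ univ, ‖uncurry (uW Pr T) z‖ₑ ^ 2 :=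
        lintegral_mono_set (prod_mono le_rfl (subset_univ K))
    _ = ∫⁻ t in Ioo 0 T, ∫⁻ x, ‖uW Pr T t x‖ₑ ^ 2 := by
        rw [Measure.volume_eq_prod, ← Measure.prod_restrict, Measure.restrict_univ,
          lintegral_prod _ hmeas.aemeasurable]
        rfl
    _ ≤ ∫⁻ t in Ioo 0 T, (ENNReal.ofReal T * eLpNorm Pr.U 2 volume) ^ 2 := by
        refine setLIntegral_mono' measurableSet_Ioo fun t ht => ?_
        have hle : eLpNorm (uW Pr T t) 2 volume ≤ ENNReal.ofReal T * eLpNorm Pr.U 2 volume := by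
          refine (eLpNorm_uW_two_le (Pr := Pr) T t).trans ?_
          exact mul_le_mul' (ENNReal.ofReal_le_ofReal (by rw [abs_of_pos ht.1]; exact ht.2.le)) le_rfl
        have h2 : ∫⁻ x, ‖uW Pr T t x‖ₑ ^ 2 = eLpNorm (uW Pr T t) 2 volume ^ 2 :=
          eEnergy_eq_eLpNorm_sq (uW Pr T t)
        rw [h2]
        exact pow_le_pow_left' hle 2
    _ < ⊤ := by
        rw [setLIntegral_const, Real.volume_Ioo]
        exact ENNReal.mul_lt_top hfin.lt_top ENNReal.ofReal_lt_top

/-- `weak`, conjunct 3: div-free slices (for every `t`, a fortiori a.e.). -/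
theorem ae_isWeaklyDivFree_uW (T : ℝ) :
    ∀ᵐ t ∂(volume.restrict (Ioo 0 T)), IsWeaklyDivFree (uW Pr T t) :=
  Eventually.of_forall fun t => isWeaklyDivFree_uW (Pr := Pr) T t

/-- Dilates of a `C¹` field are `C¹`. -/
theorem contDiff_dilate (c : ℝ) {U : ℝ³ → ℝ³} (hU : ContDiff ℝ 1 U) :
    ContDiff ℝ 1 (dilate c U) := by
  have h1 : ContDiff ℝ 1 fun x : ℝ³ => U (c • x) := hU.comp (contDiff_const_smul c)
  have h2 : dilate c U = fun x => Real.sqrt c • (c • U (c • x)) := rfl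
  rw [h2]
  exact (h1.const_smul c).const_smul (Real.sqrt c)

/-- Every slice of the witness is `C¹`. -/
theorem contDiff_uW (T t : ℝ) : ContDiff ℝ 1 (uW Pr T t) := by
  have hU : ContDiff ℝ 1 Pr.U := Pr.smooth.of_le (mod_cast le_top)
  unfold uW
  split_ifs with h
  · exact contDiff_zero_fun
  · exact (contDiff_dilate (lam T t) hU).const_smul t

end Hyps

end Summit.NavierStokesRegularity.ForcedUniquenessHygiene.KJ6
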